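import Summits.CriticalPhenomena.PercolationContinuityZ3.Theorems.PercNearOneGluingNoHeavyQuantFarSunCertTenTwo
import HarnessLib

/-!
# FAR beyond trees: **`HairyCycle.SunFAR 10 2`** — the exact configuration-level two-copy certificate for the sun graph with `K = 10` hairs at layer `j = 2` (shared-products Kronecker check, 4 shard files) — shard file 2/4 (`l ∈ {5,6,7}`)

builds on p205010 (kernel theorem, internal audit signed; external expert review pending)

Support file (`--supports stmt-CriticalPhenomena-4575`), seat `prim-cert-1` (gen 26); memo `prim-cert-1/FROM-prim-cert-1-g26-CONFIG-CERTS.md`.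
Shard 2 of 4 of the Kronecker check of the `(10,2)` certificate (`PercNearOneGluingNoHeavyQuantFarSunCertTenTwo`): prefix lengths `l ∈ {5, 6, 7}`
(1386 blocks; each shard file stays under the farm's elaboration budget).  COMPUTATIONAL (`native_decide`).
[cite: KozmaNitzan2024, Lemma 2 (p. 6), Conjecture 3 (p. 15)] (context: the lower-tail family; FAR is this programme's statement).
-/

namespace Summit.CriticalPhenomena.PercolationContinuityZ3.Theorems.HairyCycle

namespace TK


/-- Core-inequality check of the `(10, 2)` certificate, shard `l ∈ {5, 6, 7}` (1386 blocks), base `2^64` (computational;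
one `native_decide`, so the record banks are built once). [this work] -/
theorem cK102_s2 : ([5, 6, 7].all fun l => kronL2 10 64 (mkSBanks 10 2 64 (mkNTabs 10 am102 bm102)) l) = true := by
  native_decide

end TK

end Summit.CriticalPhenomena.PercolationContinuityZ3.Theorems.HairyCycle
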